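import Mathlib.Analysis.SpecialFunctions.Pow.Real
import Mathlib.Analysis.Convex.SpecificFunctions.Basic
import Mathlib.Analysis.Real.Sqrt
import Mathlib.Algebra.BigOperators.Intervals
import Literature.MathematicalPhysics.QuantumManyBody.LatticePowerSums
import HarnessLib

/-!
# Dimock, *Quantum electrodynamics on the 3-torus II*, §3.1 (128) and LEMMA 1 (129)–(131): block sums of
# `d′(x,y)^{−α}` — `∫_Δ d′(x,y)^{−α}dy ≤ O(L^{−(3−α)(k−i)})`, the two-point version and the Schwarz corollary —
# PROVED on the `ℤ³` lattice member, with explicit constants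

statement-level skeleton of published theorems with citation tags; proofs where landed; nothing here is a claim about the Yang–Mills mass gap

(Writer seat p11 = literature-prover-lit-balaban-p11-g14-0, v1.0 p320782; v1.1 (-g15-0) is DOCSTRING-ONLY: the framing
line above — no declaration added, removed or changed.)

**Citation header (reproduction of PUBLISHED work).** J. Dimock, *Quantum electrodynamics on the 3-torus. II. The
renormalization group flow*, arXiv:math-ph/0407063 (2004) [Dimock2004QED3TorusII], §3.1, p.21 of the arXiv-v1 text layer
`paper:arxiv-math-ph_0407063` (`p.NN Lnn` below = PDF page ∕ text-layer line).

**The printed statements.** On the lattice `T^{−k}_{N+M−k}` (spacing `L^{−k}`), p.21 L24–28: *"For short distances we use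
`d′(x,y) = d(x,y)` (`x ≠ y`), `L^{−k}` (`x = y`) (128). This is not a real metric but it does satisfy the triangle
inequality, and it does scale like `d(x,y)`."* p.21 L30–34: *"We note the following estimates on integrals in
`T^{−k}_{N+M−k}`. As usual `∫dy[⋯] = Σ_y L^{−3k}[⋯]`. The estimates refer to `L^{−(k−i)}` blocks `Δ` …"*
**LEMMA 1** (p.21 L36–45): *"Let `Δ` be an `L^{−(k−i)}` block with `1 ≤ i ≤ k` and let `0 ≤ α < 3`:
`∫_Δ d′(x,y)^{−α} dy ≤ O(L^{−(3−α)(k−i)})` (129); `∫_Δ d′(x,y)^{−α} d′(y,z)^{−α} dy ≤ O(L^{−(3−α)(k−i)}) d′(x,z)^{−α}`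
(130); `∫_Δ d′(x,y)^{−1} d′(y,z)^{−2} dy ≤ O(L^{−(k−i)}) d′(x,z)^{−1}` (131)."* Proof p.21 L46–57: (129) by *"if `x` is
well outside `Δ` then the integrand is bounded … If `x` is in or near `Δ` … dominated by the `ℝ³` integral
`∫_{|y|≤O(L^{−(k−i)})}|y|^{−α}dy`"*; (130) by the two cases `d′(x,y) ≥ d′(x,z)/2` ∕ `d′(y,z) ≥ d′(x,z)/2` and the triangle
inequality; (131) by *"the Schwarz inequality"* applied to `[d′(x,y)^{−1}d′(y,z)^{−1}]·[d′(y,z)^{−1}]`.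

**What is here (the `ℤ³` lattice member, every `O(1)` a closed-form constant).** Lattice points are `n ∈ ℤ³` (the
site `y = L^{−k}n`); distances are measured in the sup norm `|n|∞` (for any larger norm, e.g. the Euclidean one,
`d′^{−α}` only gets smaller, so every bound below persists); in lattice units `d′` is `dOne n = max(1, |n|∞)` and with
spacing `η = L^{−k}`, `d′(x,y) = η·dOne(x−y)` (`dprime`); a block `Δ` with `L^{i}` sites per side enters ONLY through
`#Δ ≤ R³`, `R = L^i` (so the theorems hold for every finite `U` with `#U ≤ R³`); `∫_Δ dy f = Σ_{y∈U} η³ f(y)`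
(`blockIntegral`). Then, with `C(α) = 193 + 96/(3−α)`:
* (128) `dprime_triangle`: `d′(x,z) ≤ d′(x,y) + d′(y,z)`; `dprime_comm`; scaling is built into `dprime`.
* (129) `eq129`: `∫_Δ d′(x,y)^{−α}dy ≤ C(α)·(ηR)^{3−α}`, and `ηR = L^{−k}L^{i} = L^{−(k−i)}` (`eq129_L`).
* (130) `eq130`: `∫_Δ d′(x,y)^{−α}d′(y,z)^{−α}dy ≤ 2^{α+1}C(α)·(ηR)^{3−α}·d′(x,z)^{−α}`.
* (131) `eq131`: `∫_Δ d′(x,y)^{−1}d′(y,z)^{−2}dy ≤ √8·C(2)·(ηR)·d′(x,z)^{−1}`.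
The mechanism is the printed one: shells `|n|∞ = j` carry `≤ 8·3(j+1)²` points (REUSED from the tree:
`QuantumManyBody.BoseGas.sum_shell_le_int`, file `LatticePowerSums.lean`), the radial sum `Σ_{j≤R} j^{2−α} ≤
(1 + (3−α)^{−1})R^{3−α}` (`sum_rpow_two_sub_le`, by Bernoulli's inequality for the exponent `3−α ∈ (0,1]` when
`α > 2`) is the lattice form of `∫_{|y|≤R}|y|^{−α}dy = O(R^{3−α})`, and the far points contribute `#Δ·R^{−α} ≤ R^{3−α}`.

**Not here.** The torus `T^{−k}_{N+M−k}` itself (the estimates are local: a block is smaller than the torus and the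
torus distance dominates nothing we use — we work on the `ℤ³` member, as the printed proof does via its `ℝ³` comparison);
the long-distance metric `d_Λ` (127); anything about propagators. No named facts: everything is proved.
-/

noncomputable section

open Finset Real

namespace Literature.MathematicalPhysics.QuantumFieldTheory.Dimock2011to13

namespace QED3TorusII

/-! ## §1 Lattice units: `|n|∞`, `dOne n = max(1,|n|∞)` and the triangle inequality (128) -/

/-- The sup norm `|n|∞ ∈ ℕ` of `n ∈ ℤ³` (same expression as in `QuantumManyBody/LatticePowerSums.lean`).
[cite: Dimock2004QED3TorusII, §3.1 (128) p.21 L24–28 (the distance `d(x,y)` on the lattice; sup-norm member)] -/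
def supN (n : Fin 3 → ℤ) : ℕ := univ.sup fun j => (n j).natAbs

/-- `d′` in lattice units: `dOne n = max(1, |n|∞)` — «`d′(x,y) = d(x,y)` for `x ≠ y`, `= L^{−k}` (one lattice
spacing) for `x = y`», divided by the spacing `L^{−k}`. [cite: Dimock2004QED3TorusII, §3.1 (128) p.21 L24–27] -/
def dOne (n : Fin 3 → ℤ) : ℝ := max 1 (supN n : ℝ)

variable {n a b c : Fin 3 → ℤ}

/-- `|−n|∞ = |n|∞`. [cite: Dimock2004QED3TorusII, §3.1 (128) p.21 L24–28 (symmetry of `d`)] -/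
theorem supN_neg (n : Fin 3 → ℤ) : supN (-n) = supN n := by
  unfold supN
  simp only [Pi.neg_apply, Int.natAbs_neg]

/-- `|a + b|∞ ≤ |a|∞ + |b|∞`. [cite: Dimock2004QED3TorusII, §3.1 (128) p.21 L28 («it does satisfy the triangle inequality»)] -/
theorem supN_add_le (a b : Fin 3 → ℤ) : supN (a + b) ≤ supN a + supN b := by
  unfold supN
  refine Finset.sup_le fun j _ => ?_
  calc ((a + b) j).natAbs = (a j + b j).natAbs := rfl
    _ ≤ (a j).natAbs + (b j).natAbs := Int.natAbs_add_le _ _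
    _ ≤ (univ.sup fun j => (a j).natAbs) + (univ.sup fun j => (b j).natAbs) :=
        add_le_add (Finset.le_sup (f := fun j => (a j).natAbs) (mem_univ j))
          (Finset.le_sup (f := fun j => (b j).natAbs) (mem_univ j))

/-- `1 ≤ dOne n`. [cite: Dimock2004QED3TorusII, §3.1 (128) p.21 L24–27 (`d′ ≥ L^{−k}`)] -/
theorem one_le_dOne (n : Fin 3 → ℤ) : 1 ≤ dOne n := le_max_left _ _

/-- `0 < dOne n`. [cite: Dimock2004QED3TorusII, §3.1 (128) p.21 L24–27] -/
theorem dOne_pos (n : Fin 3 → ℤ) : 0 < dOne n := lt_of_lt_of_le one_pos (one_le_dOne n)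

/-- `|n|∞ ≤ dOne n`. [cite: Dimock2004QED3TorusII, §3.1 (128) p.21 L24–27] -/
theorem supN_le_dOne (n : Fin 3 → ℤ) : (supN n : ℝ) ≤ dOne n := le_max_right _ _

/-- `dOne (−n) = dOne n`. [cite: Dimock2004QED3TorusII, §3.1 (128) p.21 L24–28] -/
theorem dOne_neg (n : Fin 3 → ℤ) : dOne (-n) = dOne n := by
  unfold dOne; rw [supN_neg]

/-- **(128), the triangle inequality** in lattice units: `dOne(a − c) ≤ dOne(a − b) + dOne(b − c)`.
[cite: Dimock2004QED3TorusII, §3.1 (128) p.21 L28 («This is not a real metric but it does satisfy the triangle inequality»)] -/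
theorem dOne_sub_le (a b c : Fin 3 → ℤ) : dOne (a - c) ≤ dOne (a - b) + dOne (b - c) := by
  have h1 : (supN (a - c) : ℝ) ≤ supN (a - b) + supN (b - c) := by
    have : a - c = (a - b) + (b - c) := by abel
    rw [this]
    exact_mod_cast supN_add_le (a - b) (b - c)
  unfold dOne
  refine max_le ?_ ?_
  · linarith [le_max_left (1 : ℝ) (supN (a - b) : ℝ), le_max_left (1 : ℝ) (supN (b - c) : ℝ)]
  · linarith [le_max_right (1 : ℝ) (supN (a - b) : ℝ), le_max_right (1 : ℝ) (supN (b - c) : ℝ)]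

/-! ## §2 The radial sum `Σ_{j=1}^{R} j^{2−α} ≤ (1 + (3−α)^{−1}) R^{3−α}` (lattice form of `∫_{|y|≤R}|y|^{−α}dy`) -/

/-- Bernoulli step for the exponent `t = 3 − α ∈ (0,1]`: `t·j^{t−1} ≤ j^t − (j−1)^t` for `j ≥ 1`.
[cite: Dimock2004QED3TorusII, §3.1 proof of Lemma 1 p.21 L49–51 («dominated by the ℝ³ integral ∫_{|y|≤O(L^{−(k−i)})}|y|^{−α}dy = O(L^{−(3−α)(k−i)})»)] -/
theorem rpow_step {t : ℝ} (ht0 : 0 ≤ t) (ht1 : t ≤ 1) {j : ℕ} (hj : 1 ≤ j) :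
    t * (j : ℝ) ^ (t - 1) ≤ (j : ℝ) ^ t - ((j : ℝ) - 1) ^ t := by
  have hj0 : (0 : ℝ) < j := by exact_mod_cast hj
  have hj1 : (1 : ℝ) ≤ j := by exact_mod_cast hj
  -- Bernoulli: `(1 − 1/j)^t ≤ 1 − t/j`
  have hs : (-1 : ℝ) ≤ -(1 / j) := by
    have : 1 / (j : ℝ) ≤ 1 := by rw [div_le_one hj0]; exact hj1
    linarith
  have hB := rpow_one_add_le_one_add_mul_self hs ht0 ht1
  -- multiply by `j^t ≥ 0`
  have hjt : 0 ≤ (j : ℝ) ^ t := Real.rpow_nonneg hj0.le t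
  have h1 : ((j : ℝ) - 1) ^ t = (j : ℝ) ^ t * (1 + -(1 / j)) ^ t := by
    rw [← Real.mul_rpow hj0.le (by linarith)]
    congr 1
    field_simp
    ring
  have h2 : (j : ℝ) ^ (t - 1) = (j : ℝ) ^ t * (1 / j) := by
    rw [Real.rpow_sub_one hj0.ne']; ring
  rw [h1, h2]
  have := mul_le_mul_of_nonneg_left hB hjt
  nlinarith

/-- The radial sum for `2 < α < 3` (`t = 3 − α ∈ (0,1)`): `(3−α)·Σ_{j=1}^R j^{2−α} ≤ R^{3−α}` (telescoping the
Bernoulli step). [cite: Dimock2004QED3TorusII, §3.1 proof of Lemma 1 p.21 L49–51] -/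
theorem sum_rpow_two_sub_le_of_lt {α : ℝ} (hα2 : 2 ≤ α) (hα3 : α < 3) (R : ℕ) :
    (3 - α) * ∑ j ∈ Icc 1 R, (j : ℝ) ^ (2 - α) ≤ (R : ℝ) ^ (3 - α) := by
  induction R with
  | zero =>
    rw [Finset.Icc_eq_empty_of_lt (by norm_num), sum_empty, mul_zero]
    exact Real.rpow_nonneg (Nat.cast_nonneg 0) _
  | succ R ih =>
    rw [Finset.sum_Icc_succ_top (by omega), mul_add]
    have hstep := rpow_step (t := 3 - α) (by linarith) (by linarith) (j := R + 1) (by omega)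
    have hcast : ((R + 1 : ℕ) : ℝ) - 1 = (R : ℝ) := by push_cast; ring
    rw [hcast] at hstep
    have hexp : (3 : ℝ) - α - 1 = 2 - α := by ring
    rw [hexp] at hstep
    linarith

/-- The radial sum for `0 ≤ α ≤ 2`: `Σ_{j=1}^R j^{2−α} ≤ R^{3−α}` (each term is at most `R^{2−α}`).
[cite: Dimock2004QED3TorusII, §3.1 proof of Lemma 1 p.21 L49–51] -/
theorem sum_rpow_two_sub_le_of_le {α : ℝ} (hα2 : α ≤ 2) (R : ℕ) :
    ∑ j ∈ Icc 1 R, (j : ℝ) ^ (2 - α) ≤ (R : ℝ) ^ (3 - α) := by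
  induction R with
  | zero =>
    rw [Finset.Icc_eq_empty_of_lt (by norm_num), sum_empty]
    exact Real.rpow_nonneg (Nat.cast_nonneg 0) _
  | succ R ih =>
    rw [Finset.sum_Icc_succ_top (by omega)]
    have hR0 : (0 : ℝ) ≤ R := Nat.cast_nonneg R
    have hR1 : (0 : ℝ) < (R : ℝ) + 1 := by linarith
    have hmono : (R : ℝ) ^ (3 - α) ≤ (R : ℝ) * ((R : ℝ) + 1) ^ (2 - α) := by
      rcases Nat.eq_zero_or_pos R with h0 | hpos
      · subst h0; simp [Real.zero_rpow (show (3 : ℝ) - α ≠ 0 by linarith)]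
      · have hR : (0 : ℝ) < R := by exact_mod_cast hpos
        rw [show (3 : ℝ) - α = (2 - α) + 1 by ring, Real.rpow_add_one hR.ne', mul_comm]
        exact mul_le_mul_of_nonneg_left
          (Real.rpow_le_rpow hR.le (by linarith) (by linarith)) hR.le
    have hsucc : ((R + 1 : ℕ) : ℝ) = (R : ℝ) + 1 := by push_cast; ring
    rw [hsucc]
    calc ∑ j ∈ Icc 1 R, (j : ℝ) ^ (2 - α) + ((R : ℝ) + 1) ^ (2 - α)
        ≤ (R : ℝ) * ((R : ℝ) + 1) ^ (2 - α) + ((R : ℝ) + 1) ^ (2 - α) := by linarith [ih.trans hmono]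
      _ = ((R : ℝ) + 1) ^ (2 - α) * ((R : ℝ) + 1) := by ring
      _ = ((R : ℝ) + 1) ^ (3 - α) := by
          rw [show (3 : ℝ) - α = (2 - α) + 1 by ring, Real.rpow_add_one hR1.ne']

/-- **The radial sum**, all `0 ≤ α < 3` at once: `Σ_{j=1}^R j^{2−α} ≤ (1 + (3−α)^{−1})·R^{3−α}` — the constant blows up
as `α → 3`, as the printed `O(1)` must. [cite: Dimock2004QED3TorusII, §3.1 proof of Lemma 1 p.21 L49–51 («∫_{|y|≤O(L^{−(k−i)})}|y|^{−α}dy = O(L^{−(3−α)(k−i)})»)] -/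
theorem sum_rpow_two_sub_le {α : ℝ} (hα3 : α < 3) (R : ℕ) :
    ∑ j ∈ Icc 1 R, (j : ℝ) ^ (2 - α) ≤ (1 + 1 / (3 - α)) * (R : ℝ) ^ (3 - α) := by
  have hRpow : 0 ≤ (R : ℝ) ^ (3 - α) := Real.rpow_nonneg (Nat.cast_nonneg R) _
  have h3 : 0 < 3 - α := by linarith
  by_cases hα2 : α ≤ 2
  · have := sum_rpow_two_sub_le_of_le hα2 R
    have : 0 ≤ 1 / (3 - α) * (R : ℝ) ^ (3 - α) := by positivity
    linarith
  · push Not at hα2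
    have h := sum_rpow_two_sub_le_of_lt hα2.le hα3 R
    have h' : ∑ j ∈ Icc 1 R, (j : ℝ) ^ (2 - α) ≤ 1 / (3 - α) * (R : ℝ) ^ (3 - α) := by
      rw [one_div, ← div_eq_inv_mul, le_div_iff₀ h3, mul_comm]; exact h
    linarith

/-! ## §3 The shell bound on `ℤ³`: `Σ_{|n|∞ ≤ R} dOne(n)^{−α} ≤ (192 + 96/(3−α))·R^{3−α}` -/

/-- The printed `O(1)` of (129), made explicit: `C(α) = 193 + 96/(3−α)` (`= 96 + 96(1 + (3−α)^{−1}) + 1`: shells,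
radial sum, and the far-field term `#Δ·R^{−α} ≤ R^{3−α}`). [cite: Dimock2004QED3TorusII, §3.1 Lemma 1 (129) p.21 L38–39 («O(L^{−(3−α)(k−i)})»)] -/
def blockConst (α : ℝ) : ℝ := 193 + 96 / (3 - α)

/-- `1 ≤ C(α)` and in particular `0 < C(α)` for `α < 3`. [cite: Dimock2004QED3TorusII, §3.1 Lemma 1 (129) p.21 L38–39] -/
theorem one_le_blockConst {α : ℝ} (hα3 : α < 3) : 1 ≤ blockConst α := by
  unfold blockConst
  have : 0 ≤ 96 / (3 - α) := div_nonneg (by norm_num) (by linarith)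
  linarith

/-- **Near field** («If `x` is in or near `Δ` … dominated by the `ℝ³` integral»): for any finite `U ⊂ ℤ³` inside the
sup-ball of radius `R ≥ 1`, `Σ_{n∈U} dOne(n)^{−α} ≤ (192 + 96/(3−α))·R^{3−α}` — shells `|n|∞ = j` have `≤ 8·3(j+1)²`
points (tree: `BoseGas.sum_shell_le_int`) and `3(j+1)²·max(1,j)^{−α} ≤ 12·max(1,j)^{2−α}`.
[cite: Dimock2004QED3TorusII, §3.1 proof of Lemma 1 (129) p.21 L47–51] -/
theorem sum_ball_le {α : ℝ} (hα3 : α < 3) (U : Finset (Fin 3 → ℤ)) {R : ℕ} (hR : 1 ≤ R)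
    (hU : ∀ n ∈ U, supN n ≤ R) :
    ∑ n ∈ U, dOne n ^ (-α) ≤ (192 + 96 / (3 - α)) * (R : ℝ) ^ (3 - α) := by
  set f : ℕ → ℝ := fun j => (max 1 (j : ℝ)) ^ (-α) with hf
  have hf0 : ∀ j, 0 ≤ f j := fun j => Real.rpow_nonneg (le_trans zero_le_one (le_max_left _ _)) _
  have h := Literature.MathematicalPhysics.QuantumManyBody.BoseGas.sum_shell_le_int U hf0 0 R
  have hfilt : U.filter (fun n => 0 ≤ (univ.sup fun j => (n j).natAbs) ∧
      (univ.sup fun j => (n j).natAbs) ≤ R) = U :=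
    Finset.filter_true_of_mem fun n hn => ⟨Nat.zero_le _, hU n hn⟩
  rw [hfilt] at h
  -- the per-shell bound `3(j+1)² f j ≤ 12 (max 1 j)^{2-α}` and the radial sum
  have h3 : 0 < 3 - α := by linarith
  have hR1 : (1 : ℝ) ≤ R := by exact_mod_cast hR
  have hRpow1 : 1 ≤ (R : ℝ) ^ (3 - α) := Real.one_le_rpow hR1 h3.le
  have hterm : ∀ j ∈ Icc 0 R, 3 * ((j : ℝ) + 1) ^ 2 * f j ≤
      12 * (if j = 0 then (1 : ℝ) else (j : ℝ) ^ (2 - α)) := by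
    intro j _
    by_cases hj : j = 0
    · subst hj
      simp only [hf, Nat.cast_zero, if_true]
      rw [max_eq_left (zero_le_one' ℝ), Real.one_rpow]; norm_num
    · have hj1 : 1 ≤ j := Nat.one_le_iff_ne_zero.2 hj
      have hj1' : (1 : ℝ) ≤ j := by exact_mod_cast hj1
      have hj0 : (0 : ℝ) < j := by linarith
      simp only [hf, if_neg hj]
      rw [max_eq_right hj1']
      have hsq := Literature.MathematicalPhysics.QuantumManyBody.BoseGas.three_mul_succ_sq_le hj1
      have hsplit : (j : ℝ) ^ (2 - α) = (j : ℝ) ^ 2 * (j : ℝ) ^ (-α) := by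
        rw [show (2 : ℝ) - α = ((2 : ℕ) : ℝ) + (-α) by push_cast; ring, Real.rpow_add hj0, Real.rpow_natCast]
      rw [hsplit]
      have : 0 ≤ (j : ℝ) ^ (-α) := Real.rpow_nonneg hj0.le _
      nlinarith
  have hsumIf : ∑ j ∈ Icc 0 R, (12 : ℝ) * (if j = 0 then (1 : ℝ) else (j : ℝ) ^ (2 - α))
      = 12 * (1 + ∑ j ∈ Icc 1 R, (j : ℝ) ^ (2 - α)) := by
    rw [← mul_sum]
    congr 1
    have hsplit : Icc 0 R = insert 0 (Icc 1 R) := by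
      ext j; simp only [mem_Icc, mem_insert]; omega
    rw [hsplit, sum_insert (by simp), if_pos rfl]
    congr 1
    exact sum_congr rfl fun j hj => by rw [if_neg (by have := (mem_Icc.1 hj).1; omega)]
  have hrad := sum_rpow_two_sub_le hα3 R
  calc ∑ n ∈ U, dOne n ^ (-α) = ∑ n ∈ U, f (univ.sup fun j => (n j).natAbs) := rfl
    _ ≤ 8 * ∑ j ∈ Icc 0 R, 3 * ((j : ℝ) + 1) ^ 2 * f j := h
    _ ≤ 8 * ∑ j ∈ Icc 0 R, (12 : ℝ) * (if j = 0 then (1 : ℝ) else (j : ℝ) ^ (2 - α)) :=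
        mul_le_mul_of_nonneg_left (sum_le_sum hterm) (by norm_num)
    _ = 96 * (1 + ∑ j ∈ Icc 1 R, (j : ℝ) ^ (2 - α)) := by rw [hsumIf]; ring
    _ ≤ 96 * ((R : ℝ) ^ (3 - α) + (1 + 1 / (3 - α)) * (R : ℝ) ^ (3 - α)) := by gcongr
    _ = (192 + 96 / (3 - α)) * (R : ℝ) ^ (3 - α) := by ring

/-! ## §4 (129) in lattice units: any finite `U` with `#U ≤ R³`, any centre `c` -/

/-- **(129) in lattice units** («if `x` is well outside `Δ` the integrand is bounded … if `x` is in or near `Δ` … the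
`ℝ³` integral»): for every finite `U ⊂ ℤ³` with `#U ≤ R³` (`R ≥ 1`), every centre `c` and `0 ≤ α < 3`,
`Σ_{n∈U} dOne(n − c)^{−α} ≤ C(α)·R^{3−α}` — near points (`|n − c|∞ ≤ R`) by `sum_ball_le`, far points contribute
`≤ #U·R^{−α} ≤ R^{3−α}`. [cite: Dimock2004QED3TorusII, §3.1 Lemma 1 (129) p.21 L38–39, proof L46–51] -/
theorem sum_block_le {α : ℝ} (hα0 : 0 ≤ α) (hα3 : α < 3) (U : Finset (Fin 3 → ℤ)) {R : ℕ} (hR : 1 ≤ R)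
    (hcard : U.card ≤ R ^ 3) (c : Fin 3 → ℤ) :
    ∑ n ∈ U, dOne (n - c) ^ (-α) ≤ blockConst α * (R : ℝ) ^ (3 - α) := by
  classical
  have hR0 : (0 : ℝ) < R := by exact_mod_cast (show 0 < R by omega)
  have hRpow : 0 ≤ (R : ℝ) ^ (3 - α) := Real.rpow_nonneg hR0.le _
  set P : (Fin 3 → ℤ) → Prop := fun n => supN (n - c) ≤ R with hP
  rw [← Finset.sum_filter_add_sum_filter_not U P]
  -- near part: translate by `c` and use the shell bound
  have hnear : ∑ n ∈ U.filter P, dOne (n - c) ^ (-α) ≤ (192 + 96 / (3 - α)) * (R : ℝ) ^ (3 - α) := by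
    have hinj : ∀ x ∈ U.filter P, ∀ y ∈ U.filter P, (fun n : Fin 3 → ℤ => n - c) x = (fun n => n - c) y →
        x = y := fun x _ y _ h => sub_left_injective h
    rw [← Finset.sum_image (f := fun m => dOne m ^ (-α)) hinj]
    refine sum_ball_le hα3 _ hR ?_
    intro m hm
    obtain ⟨n, hn, rfl⟩ := Finset.mem_image.1 hm
    exact (Finset.mem_filter.1 hn).2
  -- far part: each term `≤ R^{−α}`, at most `#U ≤ R³` of them
  have hfar : ∑ n ∈ U.filter (fun n => ¬ P n), dOne (n - c) ^ (-α) ≤ (R : ℝ) ^ (3 - α) := by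
    have hterm : ∀ n ∈ U.filter (fun n => ¬ P n), dOne (n - c) ^ (-α) ≤ (R : ℝ) ^ (-α) := by
      intro n hn
      have hgt : R < supN (n - c) := not_le.1 (Finset.mem_filter.1 hn).2
      have hle : (R : ℝ) ≤ dOne (n - c) := le_trans (by exact_mod_cast hgt.le) (supN_le_dOne _)
      exact Real.rpow_le_rpow_of_nonpos hR0 hle (by linarith)
    have hcardR : ((U.filter (fun n => ¬ P n)).card : ℝ) ≤ (R : ℝ) ^ 3 := by
      exact_mod_cast (Finset.card_filter_le _ _).trans hcard
    calc ∑ n ∈ U.filter (fun n => ¬ P n), dOne (n - c) ^ (-α)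
        ≤ ∑ n ∈ U.filter (fun n => ¬ P n), (R : ℝ) ^ (-α) := sum_le_sum hterm
      _ = ((U.filter (fun n => ¬ P n)).card : ℝ) * (R : ℝ) ^ (-α) := by rw [sum_const, nsmul_eq_mul]
      _ ≤ (R : ℝ) ^ 3 * (R : ℝ) ^ (-α) := mul_le_mul_of_nonneg_right hcardR (Real.rpow_nonneg hR0.le _)
      _ = (R : ℝ) ^ (3 - α) := by
          rw [show (3 : ℝ) - α = ((3 : ℕ) : ℝ) + (-α) by push_cast; ring, Real.rpow_add hR0,
            Real.rpow_natCast]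
  unfold blockConst
  calc ∑ n ∈ U.filter P, dOne (n - c) ^ (-α) + ∑ n ∈ U.filter (fun n => ¬ P n), dOne (n - c) ^ (-α)
      ≤ (192 + 96 / (3 - α)) * (R : ℝ) ^ (3 - α) + (R : ℝ) ^ (3 - α) := add_le_add hnear hfar
    _ = (193 + 96 / (3 - α)) * (R : ℝ) ^ (3 - α) := by ring

/-! ## §5 The paper's normalization: spacing `η = L^{−k}`, `d′ = η·dOne`, `∫_Δ dy = Σ η³`; (128) and (129) -/

/-- **`d′(x,y)`** of (128) for lattice sites `x, y ∈ ℤ³` at spacing `η = L^{−k}`: `η·max(1, |x − y|∞)` («`d(x,y)`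
for `x ≠ y`, `L^{−k}` for `x = y`»; sup-norm member). [cite: Dimock2004QED3TorusII, §3.1 (128) p.21 L24–27] -/
def dprime (η : ℝ) (x y : Fin 3 → ℤ) : ℝ := η * dOne (x - y)

/-- **`∫_Δ dy f(y) = Σ_{y∈Δ} L^{−3k} f(y)`** («As usual `∫dy[⋯] = Σ_y L^{−3k}[⋯]`»), with `η = L^{−k}` and the block's
sites listed by `U`. [cite: Dimock2004QED3TorusII, §3.1 p.21 L30–34] -/
def blockIntegral (η : ℝ) (U : Finset (Fin 3 → ℤ)) (f : (Fin 3 → ℤ) → ℝ) : ℝ := ∑ y ∈ U, η ^ 3 * f y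

variable {η : ℝ} {x y z : Fin 3 → ℤ}

/-- `d′` is symmetric. [cite: Dimock2004QED3TorusII, §3.1 (128) p.21 L24–28] -/
theorem dprime_comm (η : ℝ) (x y : Fin 3 → ℤ) : dprime η x y = dprime η y x := by
  unfold dprime
  rw [← dOne_neg, neg_sub]

/-- `d′ > 0` (for spacing `η > 0`). [cite: Dimock2004QED3TorusII, §3.1 (128) p.21 L24–27] -/
theorem dprime_pos (hη : 0 < η) (x y : Fin 3 → ℤ) : 0 < dprime η x y := mul_pos hη (dOne_pos _)

/-- `d′(x,y) ≥ L^{−k}` (the spacing). [cite: Dimock2004QED3TorusII, §3.1 (128) p.21 L24–27] -/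
theorem spacing_le_dprime (hη : 0 ≤ η) (x y : Fin 3 → ℤ) : η ≤ dprime η x y :=
  le_mul_of_one_le_right hη (one_le_dOne _)

/-- «it does scale like `d(x,y)`»: `d′` at spacing `η` is `η` times `d′` at spacing `1`.
[cite: Dimock2004QED3TorusII, §3.1 (128) p.21 L28] -/
theorem dprime_scale (η : ℝ) (x y : Fin 3 → ℤ) : dprime η x y = η * dprime 1 x y := by
  unfold dprime; rw [one_mul]

/-- **(128): the triangle inequality** «This is not a real metric but it does satisfy the triangle inequality».
[cite: Dimock2004QED3TorusII, §3.1 (128) p.21 L28] -/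
theorem dprime_triangle (hη : 0 ≤ η) (x y z : Fin 3 → ℤ) : dprime η x z ≤ dprime η x y + dprime η y z := by
  unfold dprime
  rw [← mul_add]
  exact mul_le_mul_of_nonneg_left (dOne_sub_le x y z) hη

/-- **LEMMA 1 (129)**: `∫_Δ d′(x,y)^{−α} dy ≤ C(α)·(ηR)^{3−α}` for every `x`, every finite `U` («block `Δ`») with
`#U ≤ R³`, spacing `η > 0`, `0 ≤ α < 3`; with `η = L^{−k}`, `R = L^{i}`: `(ηR)^{3−α} = L^{−(3−α)(k−i)}` (`eq129_L`).
[cite: Dimock2004QED3TorusII, §3.1 Lemma 1 (129) p.21 L36–39, proof L46–51] -/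
theorem eq129 {α η : ℝ} (hα0 : 0 ≤ α) (hα3 : α < 3) (hη : 0 < η) (U : Finset (Fin 3 → ℤ)) {R : ℕ}
    (hR : 1 ≤ R) (hcard : U.card ≤ R ^ 3) (x : Fin 3 → ℤ) :
    blockIntegral η U (fun y => dprime η x y ^ (-α)) ≤ blockConst α * (η * R) ^ (3 - α) := by
  have hη0 := hη.le
  unfold blockIntegral dprime
  have hterm : ∀ y ∈ U, η ^ 3 * (η * dOne (x - y)) ^ (-α) = (η ^ 3 * η ^ (-α)) * dOne (y - x) ^ (-α) := by
    intro y _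
    rw [Real.mul_rpow hη0 (dOne_pos _).le, ← dOne_neg, neg_sub]
    ring
  rw [sum_congr rfl hterm, ← mul_sum]
  have hsum := sum_block_le hα0 hα3 U hR hcard x
  have hfac : 0 ≤ η ^ 3 * η ^ (-α) := mul_nonneg (pow_nonneg hη0 3) (Real.rpow_nonneg hη0 _)
  calc (η ^ 3 * η ^ (-α)) * ∑ y ∈ U, dOne (y - x) ^ (-α)
      ≤ (η ^ 3 * η ^ (-α)) * (blockConst α * (R : ℝ) ^ (3 - α)) := mul_le_mul_of_nonneg_left hsum hfac
    _ = blockConst α * (η * R) ^ (3 - α) := by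
        rw [Real.mul_rpow hη0 (Nat.cast_nonneg R),
          show (3 : ℝ) - α = ((3 : ℕ) : ℝ) + (-α) by push_cast; ring, Real.rpow_add hη, Real.rpow_natCast]
        ring

/-- The scale bookkeeping `η·R = L^{−k}·L^{i} = L^{−(k−i)}` for `i ≤ k`, `L ≥ 1`.
[cite: Dimock2004QED3TorusII, §3.1 Lemma 1 p.21 L35–39 («`L^{−(k−i)}` blocks `Δ` … `O(L^{−(3−α)(k−i)})`»)] -/
theorem spacing_mul_side {L : ℕ} (hL : 1 ≤ L) {i k : ℕ} (hik : i ≤ k) :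
    ((L : ℝ) ^ k)⁻¹ * ((L ^ i : ℕ) : ℝ) = ((L : ℝ) ^ (k - i))⁻¹ := by
  have hL0 : (L : ℝ) ≠ 0 := by exact_mod_cast (show L ≠ 0 by omega)
  obtain ⟨d, rfl⟩ := Nat.exists_eq_add_of_le hik
  rw [Nat.add_sub_cancel_left, pow_add]
  push_cast
  field_simp

/-- **(129) in the paper's letters**: `η = L^{−k}`, an `L^{−(k−i)}` block (`#Δ ≤ (L^i)³` sites), `1 ≤ L`, `i ≤ k`:
`∫_Δ d′(x,y)^{−α}dy ≤ C(α)·(L^{−(k−i)})^{3−α} = O(L^{−(3−α)(k−i)})`.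
[cite: Dimock2004QED3TorusII, §3.1 Lemma 1 (129) p.21 L36–39] -/
theorem eq129_L {α : ℝ} (hα0 : 0 ≤ α) (hα3 : α < 3) {L : ℕ} (hL : 1 ≤ L) {i k : ℕ} (hik : i ≤ k)
    (U : Finset (Fin 3 → ℤ)) (hcard : U.card ≤ (L ^ i) ^ 3) (x : Fin 3 → ℤ) :
    blockIntegral ((L : ℝ) ^ k)⁻¹ U (fun y => dprime ((L : ℝ) ^ k)⁻¹ x y ^ (-α))
      ≤ blockConst α * (((L : ℝ) ^ (k - i))⁻¹) ^ (3 - α) := by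
  have hL0 : (0 : ℝ) < L := by exact_mod_cast (show 0 < L by omega)
  have hη : 0 < ((L : ℝ) ^ k)⁻¹ := by positivity
  have hR : 1 ≤ L ^ i := Nat.one_le_pow _ _ (by omega)
  have h := eq129 hα0 hα3 hη U hR hcard x
  rwa [spacing_mul_side hL hik] at h

/-! ## §6 LEMMA 1 (130): the two-centre sum -/

/-- The pointwise step of (130): if `c ≤ a + b` (`a, b, c > 0`, `α ≥ 0`) then
`a^{−α}b^{−α} ≤ 2^{α}c^{−α}(a^{−α} + b^{−α})` — «The first case is `d′(x,y) ≥ d′(x,z)/2` … The second case … by the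
triangle inequality `d′(y,z) ≥ d′(x,z)/2`». [cite: Dimock2004QED3TorusII, §3.1 proof of Lemma 1 (130) p.21 L52–55] -/
theorem rpow_neg_mul_rpow_neg_le {a b c α : ℝ} (ha : 0 < a) (hb : 0 < b) (hc : 0 < c) (hα : 0 ≤ α)
    (habc : c ≤ a + b) : a ^ (-α) * b ^ (-α) ≤ 2 ^ α * c ^ (-α) * (a ^ (-α) + b ^ (-α)) := by
  have hα' : -α ≤ 0 := by linarith
  have haα : 0 ≤ a ^ (-α) := Real.rpow_nonneg ha.le _
  have hbα : 0 ≤ b ^ (-α) := Real.rpow_nonneg hb.le _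
  have h2c : 0 ≤ 2 ^ α * c ^ (-α) := mul_nonneg (Real.rpow_nonneg zero_le_two _) (Real.rpow_nonneg hc.le _)
  have half : ∀ {d : ℝ}, 0 < d → c / 2 ≤ d → d ^ (-α) ≤ 2 ^ α * c ^ (-α) := by
    intro d _ hcd
    calc d ^ (-α) ≤ (c / 2) ^ (-α) := Real.rpow_le_rpow_of_nonpos (by positivity) hcd hα'
      _ = 2 ^ α * c ^ (-α) := by
          rw [Real.div_rpow hc.le zero_le_two, Real.rpow_neg zero_le_two, div_inv_eq_mul, mul_comm]
  rcases le_or_gt (c / 2) a with h | h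
  · calc a ^ (-α) * b ^ (-α) ≤ (2 ^ α * c ^ (-α)) * b ^ (-α) :=
          mul_le_mul_of_nonneg_right (half ha h) hbα
      _ ≤ 2 ^ α * c ^ (-α) * (a ^ (-α) + b ^ (-α)) := by
          rw [mul_add]; linarith [mul_nonneg h2c haα]
  · have hb2 : c / 2 ≤ b := by linarith
    calc a ^ (-α) * b ^ (-α) ≤ a ^ (-α) * (2 ^ α * c ^ (-α)) :=
          mul_le_mul_of_nonneg_left (half hb hb2) haα
      _ ≤ 2 ^ α * c ^ (-α) * (a ^ (-α) + b ^ (-α)) := by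
          rw [mul_add]; linarith [mul_nonneg h2c hbα]

/-- **LEMMA 1 (130)**: `∫_Δ d′(x,y)^{−α} d′(y,z)^{−α} dy ≤ 2^{α+1}C(α)·(ηR)^{3−α}·d′(x,z)^{−α}` (same `U`, `R`, `η`,
`α` as in (129)). [cite: Dimock2004QED3TorusII, §3.1 Lemma 1 (130) p.21 L40–42, proof L52–55] -/
theorem eq130 {α η : ℝ} (hα0 : 0 ≤ α) (hα3 : α < 3) (hη : 0 < η) (U : Finset (Fin 3 → ℤ)) {R : ℕ}
    (hR : 1 ≤ R) (hcard : U.card ≤ R ^ 3) (x z : Fin 3 → ℤ) :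
    blockIntegral η U (fun y => dprime η x y ^ (-α) * dprime η y z ^ (-α))
      ≤ 2 ^ (α + 1) * blockConst α * (η * R) ^ (3 - α) * dprime η x z ^ (-α) := by
  have hη3 : 0 ≤ η ^ 3 := pow_nonneg hη.le 3
  have hpt : ∀ y ∈ U, η ^ 3 * (dprime η x y ^ (-α) * dprime η y z ^ (-α))
      ≤ 2 ^ α * dprime η x z ^ (-α) * (η ^ 3 * dprime η x y ^ (-α))
        + 2 ^ α * dprime η x z ^ (-α) * (η ^ 3 * dprime η z y ^ (-α)) := by
    intro y _
    have h := rpow_neg_mul_rpow_neg_le (dprime_pos hη x y) (dprime_pos hη y z) (dprime_pos hη x z) hα0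
      (dprime_triangle hη.le x y z)
    rw [dprime_comm η z y]
    calc η ^ 3 * (dprime η x y ^ (-α) * dprime η y z ^ (-α))
        ≤ η ^ 3 * (2 ^ α * dprime η x z ^ (-α) * (dprime η x y ^ (-α) + dprime η y z ^ (-α))) :=
          mul_le_mul_of_nonneg_left h hη3
      _ = _ := by ring
  have hc : 0 ≤ 2 ^ α * dprime η x z ^ (-α) :=
    mul_nonneg (Real.rpow_nonneg zero_le_two _) (Real.rpow_nonneg (dprime_pos hη x z).le _)
  have h1 := eq129 hα0 hα3 hη U hR hcard x
  have h2 := eq129 hα0 hα3 hη U hR hcard z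
  unfold blockIntegral at h1 h2 ⊢
  calc ∑ y ∈ U, η ^ 3 * (dprime η x y ^ (-α) * dprime η y z ^ (-α))
      ≤ ∑ y ∈ U, (2 ^ α * dprime η x z ^ (-α) * (η ^ 3 * dprime η x y ^ (-α))
          + 2 ^ α * dprime η x z ^ (-α) * (η ^ 3 * dprime η z y ^ (-α))) := sum_le_sum hpt
    _ = 2 ^ α * dprime η x z ^ (-α) *
          (∑ y ∈ U, η ^ 3 * dprime η x y ^ (-α) + ∑ y ∈ U, η ^ 3 * dprime η z y ^ (-α)) := by
        rw [sum_add_distrib, mul_add, mul_sum, mul_sum]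
    _ ≤ 2 ^ α * dprime η x z ^ (-α) * (blockConst α * (η * R) ^ (3 - α) + blockConst α * (η * R) ^ (3 - α)) :=
        mul_le_mul_of_nonneg_left (add_le_add h1 h2) hc
    _ = 2 ^ (α + 1) * blockConst α * (η * R) ^ (3 - α) * dprime η x z ^ (-α) := by
        rw [Real.rpow_add_one two_ne_zero]; ring

/-! ## §7 LEMMA 1 (131): the Schwarz-inequality corollary -/

/-- **LEMMA 1 (131)**: `∫_Δ d′(x,y)^{−1} d′(y,z)^{−2} dy ≤ √8·C(2)·(ηR)·d′(x,z)^{−1}` — «regard the integrand as the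
product of `d′(x,y′)^{−1}d′(y′,z)^{−1}` and `d′(y′,z)^{−1}` and use the Schwarz inequality», then (130) and (129)
at `α = 2`. [cite: Dimock2004QED3TorusII, §3.1 Lemma 1 (131) p.21 L43–45, proof L56–57] -/
theorem eq131 {η : ℝ} (hη : 0 < η) (U : Finset (Fin 3 → ℤ)) {R : ℕ} (hR : 1 ≤ R) (hcard : U.card ≤ R ^ 3)
    (x z : Fin 3 → ℤ) :
    blockIntegral η U (fun y => dprime η x y ^ (-(1 : ℝ)) * dprime η y z ^ (-(2 : ℝ)))
      ≤ Real.sqrt 8 * blockConst 2 * (η * R) * dprime η x z ^ (-(1 : ℝ)) := by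
  set f : (Fin 3 → ℤ) → ℝ := fun y => dprime η x y ^ (-(1 : ℝ)) * dprime η y z ^ (-(1 : ℝ)) with hf
  set g : (Fin 3 → ℤ) → ℝ := fun y => dprime η y z ^ (-(1 : ℝ)) with hg
  have hd := fun (a b : Fin 3 → ℤ) => dprime_pos hη a b
  have hfg : ∀ y, dprime η x y ^ (-(1 : ℝ)) * dprime η y z ^ (-(2 : ℝ)) = f y * g y := by
    intro y
    simp only [hf, hg]
    rw [show (-(2 : ℝ)) = -(1 : ℝ) + -(1 : ℝ) by norm_num, Real.rpow_add (hd y z)]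
    ring
  have hsq : ∀ (t : ℝ), 0 < t → (t ^ (-(1 : ℝ))) ^ 2 = t ^ (-(2 : ℝ)) := by
    intro t ht
    rw [← Real.rpow_natCast (t ^ (-(1 : ℝ))) 2, ← Real.rpow_mul ht.le]
    norm_num
  have hf2 : ∀ y, f y ^ 2 = dprime η x y ^ (-(2 : ℝ)) * dprime η y z ^ (-(2 : ℝ)) := by
    intro y; simp only [hf]; rw [mul_pow, hsq _ (hd x y), hsq _ (hd y z)]
  have hg2 : ∀ y, g y ^ 2 = dprime η z y ^ (-(2 : ℝ)) := by
    intro y; simp only [hg]; rw [dprime_comm η y z, hsq _ (hd z y)]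
  -- the two inputs at `α = 2`
  have h130 := eq130 (α := 2) (by norm_num) (by norm_num) hη U hR hcard x z
  have h129 := eq129 (α := 2) (by norm_num) (by norm_num) hη U hR hcard z
  have h8 : (2 : ℝ) ^ ((2 : ℝ) + 1) = 8 := by
    rw [show (2 : ℝ) + 1 = ((3 : ℕ) : ℝ) by norm_num, Real.rpow_natCast]; norm_num
  have hηR1 : (η * R) ^ ((3 : ℝ) - 2) = η * R := by
    rw [show (3 : ℝ) - 2 = 1 by norm_num, Real.rpow_one]
  rw [h8, hηR1] at h130
  rw [hηR1] at h129
  have hη3 : 0 ≤ η ^ 3 := pow_nonneg hη.le 3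
  have hF : η ^ 3 * ∑ y ∈ U, f y ^ 2 ≤ 8 * blockConst 2 * (η * R) * dprime η x z ^ (-(2 : ℝ)) := by
    have : η ^ 3 * ∑ y ∈ U, f y ^ 2 =
        blockIntegral η U (fun y => dprime η x y ^ (-(2 : ℝ)) * dprime η y z ^ (-(2 : ℝ))) := by
      unfold blockIntegral; rw [mul_sum]; exact sum_congr rfl fun y _ => by rw [hf2]
    rw [this]; exact h130
  have hG : η ^ 3 * ∑ y ∈ U, g y ^ 2 ≤ blockConst 2 * (η * R) := by
    have : η ^ 3 * ∑ y ∈ U, g y ^ 2 = blockIntegral η U (fun y => dprime η z y ^ (-(2 : ℝ))) := by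
      unfold blockIntegral; rw [mul_sum]; exact sum_congr rfl fun y _ => by rw [hg2]
    rw [this]; exact h129
  have hCS := Real.sum_mul_le_sqrt_mul_sqrt U f g
  have hc : 0 < dprime η x z := hd x z
  have hc1 : 0 ≤ dprime η x z ^ (-(1 : ℝ)) := Real.rpow_nonneg hc.le _
  have hC : 0 ≤ blockConst 2 := le_trans zero_le_one (one_le_blockConst (by norm_num))
  have hηR : 0 ≤ η * R := mul_nonneg hη.le (Nat.cast_nonneg R)
  have hin : 0 ≤ 8 * blockConst 2 * (η * R) * dprime η x z ^ (-(2 : ℝ)) :=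
    mul_nonneg (by positivity) (Real.rpow_nonneg hc.le _)
  unfold blockIntegral
  calc ∑ y ∈ U, η ^ 3 * (dprime η x y ^ (-(1 : ℝ)) * dprime η y z ^ (-(2 : ℝ)))
      = η ^ 3 * ∑ y ∈ U, f y * g y := by
        rw [mul_sum]; exact sum_congr rfl fun y _ => by rw [hfg]
    _ ≤ η ^ 3 * (Real.sqrt (∑ y ∈ U, f y ^ 2) * Real.sqrt (∑ y ∈ U, g y ^ 2)) :=
        mul_le_mul_of_nonneg_left hCS hη3
    _ = Real.sqrt (η ^ 3 * ∑ y ∈ U, f y ^ 2) * Real.sqrt (η ^ 3 * ∑ y ∈ U, g y ^ 2) := by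
        rw [Real.sqrt_mul hη3, Real.sqrt_mul hη3,
          show Real.sqrt (η ^ 3) * Real.sqrt (∑ y ∈ U, f y ^ 2) * (Real.sqrt (η ^ 3) * Real.sqrt (∑ y ∈ U, g y ^ 2))
            = (Real.sqrt (η ^ 3) * Real.sqrt (η ^ 3)) *
              (Real.sqrt (∑ y ∈ U, f y ^ 2) * Real.sqrt (∑ y ∈ U, g y ^ 2)) by ring,
          Real.mul_self_sqrt hη3]
    _ ≤ Real.sqrt (8 * blockConst 2 * (η * R) * dprime η x z ^ (-(2 : ℝ))) * Real.sqrt (blockConst 2 * (η * R)) :=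
        mul_le_mul (Real.sqrt_le_sqrt hF) (Real.sqrt_le_sqrt hG) (Real.sqrt_nonneg _) (Real.sqrt_nonneg _)
    _ = Real.sqrt 8 * blockConst 2 * (η * R) * dprime η x z ^ (-(1 : ℝ)) := by
        rw [← Real.sqrt_mul hin, ← hsq _ hc,
          show 8 * blockConst 2 * (η * R) * (dprime η x z ^ (-(1 : ℝ))) ^ 2 * (blockConst 2 * (η * R))
            = 8 * ((blockConst 2 * (η * R) * dprime η x z ^ (-(1 : ℝ))) *
                (blockConst 2 * (η * R) * dprime η x z ^ (-(1 : ℝ)))) by ring,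
          Real.sqrt_mul (by norm_num : (0 : ℝ) ≤ 8), Real.sqrt_mul_self (by positivity)]
        ring

end QED3TorusII

end Literature.MathematicalPhysics.QuantumFieldTheory.Dimock2011to13

end
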